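import Summits.ResolutionOfSingularities.ResolutionOfSingularities.Theorems.PurelyInseparableDim4ChartClosureSNC
import Summits.ResolutionOfSingularities.ResolutionOfSingularities.Theorems.PurelyInseparableDim4ChartClosureIdealInside
import Summits.ResolutionOfSingularities.ResolutionOfSingularities.Theorems.PurelyInseparableDim4ChartClosureSupport
import Summits.ResolutionOfSingularities.ResolutionOfSingularities.Theorems.PurelyInseparableDim4ChartBoundary
import Literature.AlgebraicGeometry.Resolution.RegularCentreComponents
import Mathlib.AlgebraicGeometry.Noetherian
import HarnessLib

/-!
# Purely inseparable four-folds `z^p + F(x₁, …, x₄)`: the closure of a chart centre INSIDE the exceptional divisor is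
# an ADMISSIBLE centre — the S3-glob question at depth 2, case `j ∈ S'`, and the package for EVERY `S'`
# (brick S3-glob, part C1; cell `res-dim4-pi`, typ-2 g4)

[OURS · counted 0] (D-0157 DOOR 2; DR-157-C; desk WORD #97 (c); frame `PIDim4.TerminationImpliesOrderReduction`, S3 (c)).
Setting of `…ChartClosureStrict`; now the next centre `S'` CONTAINS the chart index `j` (its chart image lies in the
exceptional divisor `E₁`). With `S″ = S' ∖ {j}`, `Y″ = V(J″)` the graph of A2/B1 for `S″` (with the `S'`-lift `H`),
`T″ = V(St_π(𝒥_{Y″}))` its strict transform and `Z' = St_π(𝒥_{Y″}) + 𝓘_{E₁}` (the regular scheme `E₁ ∩ T″`, D2 §2):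

* `comap_chart_strictTransformIdeal_graph_erase_sup` — **`φ^* Z' = 𝓘Λ_{S'}`** (A3 transported);
* `hasSNCWith_exceptional_strictTransformIdeal_graph_sup` — `HasSNCWith [𝓘_{E₁}] Z'` (pointwise Matsumura 14.2, as in D2);
* `closure_mem_componentsIn_of_inter_range` (point-set) and `closureImage_mem_boundaryPieces` — the closure `T` of the
  chart centre is an IRREDUCIBLE COMPONENT (a piece) of `V(Z')`: a non-empty open irreducible part of a closed set is
  dense in every irreducible subset containing it;
* **`isRegular_globalCentre_of_reading_of_mem`**, **`hasSNCWith_transform_boundary_globalCentre_of_mem`** — Q1 and Q3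
  for `j ∈ S'` (pieces of a regular snc centre are regular snc centres: tree `RegularCentreComponents`);
* **`isRegular_globalCentre_of_reading`**, **`hasSNCWith_transform_boundary_globalCentre`** — Q1, Q3 for EVERY `S'`
  (with B2/D2 for `j ∉ S'`), and **`globalCentre_admissible_package`** — THE SIGNATURE OF RECORD (HOME
  `lean-g4/ChartClosureSignature.lean`, WORD #97 (c)): for every presented state, permissible `S ∋ j`, any blow-up along
  `V(z, x_S)`, point `b` (`b_j = 0`) and ANY next centre `S'` permissible for `step p S j b s` — escaping or not, inside
  `E₁` or not — the global centre `Zc = 𝓘(closure φ(V(z, x_{S'})))` is an ADMISSIBLE BGMW centre on `W₁` (regular,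
  inside the support, snc with `[E₁]`), reading `𝓘Λ_{S'}` on the chart while the transform reads `z^p + (step p S j b s).F`.

HONEST SCOPE: depth 2 from the root (boundary `[E₁]`); `K` algebraically closed for the package (perfect for Q2); nothing
about the walk over `closure ∖ image`, nothing about termination; resolution of singularities in dimension ≥ 4 /
characteristic `p` is NOT proved anywhere in this programme. bears_on: LADDER-RESOLUTION:D157-DOOR2 (res-dim4-pi).
Supports stmt-ResolutionOfSingularities-16155 (helper, S3-glob C1).
-/

-- every declaration of this summit lives under `Summit.ResolutionOfSingularities.ResolutionOfSingularities`
-- (summit = problem), which the duplicate-namespace linter flags; house convention (cf. the Target file).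
set_option linter.dupNamespace false

noncomputable section

open MvPolynomial Finset CategoryTheory AlgebraicGeometry Opposite TopologicalSpace IsLocalRing
open AlgebraicGeometry.Scheme.IdealSheafData (ofIdealTop vanishingIdeal)

namespace Summit.ResolutionOfSingularities.ResolutionOfSingularities.Theorems.PIDim4

open Literature.AlgebraicGeometry.Resolution
open Literature.AlgebraicGeometry.Resolution.AffinePointBlowup (P A γ coord Wtop ξ)

namespace ChartDictionary

/-! ## §1 Point-set: the closure of an open irreducible part is an irreducible component -/

/-- **A non-empty irreducible set which is the trace of an open set on a closed set `Z` has closure an irreducible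
component of `Z`**: every irreducible `T ⊆ Z` containing it meets the open set in a dense part of itself. -/
theorem closure_mem_componentsIn_of_inter_range {X : Type*} [TopologicalSpace X] {Z U O : Set X} (hZ : IsClosed Z)
    (hU : IsOpen U) (hO : Z ∩ U = O) (hirr : IsIrreducible O) : closure O ∈ componentsIn Z := by
  rw [mem_componentsIn_iff]
  have hOZ : O ⊆ Z := fun x hx => (hO ▸ hx : x ∈ Z ∩ U).1
  refine ⟨hZ.closure_subset_iff.mpr hOZ, hirr.closure, fun T hTZ hT hOT => ?_⟩
  have hTU : T ∩ U ⊆ O := fun x hx => hO ▸ ⟨hTZ hx.1, hx.2⟩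
  have hne : (T ∩ U).Nonempty := by
    obtain ⟨x, hx⟩ := hirr.1
    exact ⟨x, hOT (subset_closure hx), (hO ▸ hx : x ∈ Z ∩ U).2⟩
  exact (subset_closure_inter_of_isPreirreducible_of_isOpen hT.2 hU hne).trans (closure_mono hTU)

/-! ## §2 The regular snc centre `Z' = E₁ ∩ T″` and its chart reading -/

section Scheme

variable {K : Type} [Field K] {p : ℕ} {S S' : Finset (Fin 4)} {j : Fin 4} {b : Fin 4 → K}
  {Θ : A 4 K ≃ₐ[K] A 4 K} {h : MvPolynomial (Fin 4) K} {F F₁ : MvPolynomial (Fin 4) K}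
  {W : Scheme.{0}} {π : W ⟶ P 4 K}

/-- **`φ^* Z' = 𝓘Λ_{S'}`**: on the re-centred chart the regular scheme `E₁ ∩ T″` (`T″` the strict transform of the graph
`Y″` for `S″ = S' ∖ {j}`) reads the next centre `V(z, x_{S'})` (A3's ring identity transported). -/
theorem comap_chart_strictTransformIdeal_graph_erase_sup (hj : j ∈ S) (hjS' : j ∈ S') (hbj : b j = 0)
    (h0 : Θ (X 0) = X 0 + rename Fin.succ h) (hs : ∀ i : Fin 4, Θ (X i.succ) = X i.succ + C (b i))
    (hπ : IsBlowup π (AffineCoordBlowup.𝓘Λ 4 K (insert 0 (Fin.succ '' (S : Set (Fin 4))))))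
    {H : MvPolynomial (Fin 4) K} (hH : coordBlowupSubst K (S : Set (Fin 4)) j H =
      X j * aeval (fun k => if k ∈ S' then (0 : MvPolynomial (Fin 4) K) else X k - C (b k)) h) :
    (strictTransformIdeal π (AffineCoordBlowup.𝓘Λ 4 K (insert 0 (Fin.succ '' (S : Set (Fin 4)))))
        (Hironaka2005.idealSheafOf (Ideal.span (insert (X 0 - rename Fin.succ H)
          (((fun k : Fin 4 => (X k.succ - C (b k) : A 4 K)) '' ((S'.erase j \ S : Finset (Fin 4)) : Set (Fin 4))) ∪
           ((fun i : Fin 4 => (X i.succ - C (b i) * X j.succ : A 4 K)) ''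
             ((S'.erase j ∩ S : Finset (Fin 4)) : Set (Fin 4))))))) ⊔
      (AffineCoordBlowup.𝓘Λ 4 K (insert 0 (Fin.succ '' (S : Set (Fin 4))))).comap π).comap
      (Spec.map (CommRingCat.ofHom (Θ : A 4 K →+* A 4 K)) ≫ AffineCoordBlowup.chartImm hπ (succ_mem_centreVars hj)) =
      AffineCoordBlowup.𝓘Λ 4 K (insert 0 (Fin.succ '' (S' : Set (Fin 4)))) := by
  have hΘj : (Θ : A 4 K →+* A 4 K) (X j.succ) = X j.succ := by
    rw [RingHom.coe_coe, hs j, hbj, C_0, add_zero]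
  have hE : ofIdealTop (Ideal.span {coord 4 K j.succ}) = Hironaka2005.idealSheafOf (Ideal.span {(X j.succ : A 4 K)}) := by
    rw [Hironaka2005.idealSheafOf, Ideal.map_span, Set.image_singleton]
    rfl
  rw [(Scheme.IdealSheafData.map_gc _).l_sup, Scheme.IdealSheafData.comap_comp,
    comap_chartImm_strictTransformIdeal_idealSheafOf hj hπ, Hironaka2005.comap_specMap_idealSheafOf,
    comap_exceptional_chart hj hΘj hπ, hE, ← Hironaka2005.idealSheafOf_sup,
    map_clean_coordStrictTransformIdeal_graph_erase_sup hjS' hbj h0 hs hH,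
    ← Cruxes.EquisingularLiftNat.Sections.ND.𝓘Λ_eq_idealSheafOf]

/-- **`HasSNCWith [𝓘_{E₁}] (St_π(𝒥_{Y″}) + 𝓘_{E₁})`**: the regular scheme `E₁ ∩ T″` — a centre INSIDE the boundary
divisor — has simple normal crossings with `[E₁]` (pointwise: the exceptional equation `e` joins local generators of
`T″` in a regular system of parameters, D2's `exists_isRsopPart_labels_of_saturated`). Here `S'` is any centre NOT
containing `j` (apply with `S' ∖ {j}`). -/
theorem hasSNCWith_exceptional_strictTransformIdeal_graph_sup (hj : j ∈ S) (hjS' : j ∉ S')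
    (hπ : IsBlowup π (AffineCoordBlowup.𝓘Λ 4 K (insert 0 (Fin.succ '' (S : Set (Fin 4))))))
    {H : MvPolynomial (Fin 4) K} (hHS : H ∈ Ideal.span (X '' (S : Set (Fin 4)) : Set (MvPolynomial (Fin 4) K))) :
    HasSNCWith [(AffineCoordBlowup.𝓘Λ 4 K (insert 0 (Fin.succ '' (S : Set (Fin 4))))).comap π]
      (strictTransformIdeal π (AffineCoordBlowup.𝓘Λ 4 K (insert 0 (Fin.succ '' (S : Set (Fin 4)))))
        (Hironaka2005.idealSheafOf (Ideal.span (insert (X 0 - rename Fin.succ H)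
          (((fun k : Fin 4 => (X k.succ - C (b k) : A 4 K)) '' ((S' \ S : Finset (Fin 4)) : Set (Fin 4))) ∪
           ((fun i : Fin 4 => (X i.succ - C (b i) * X j.succ : A 4 K)) '' ((S' ∩ S : Finset (Fin 4)) : Set (Fin 4))))))) ⊔
        (AffineCoordBlowup.𝓘Λ 4 K (insert 0 (Fin.succ '' (S : Set (Fin 4))))).comap π) := by
  set C₀ := AffineCoordBlowup.𝓘Λ 4 K (insert 0 (Fin.succ '' (S : Set (Fin 4)))) with hC₀
  set St := strictTransformIdeal π C₀
        (Hironaka2005.idealSheafOf (Ideal.span (insert (X 0 - rename Fin.succ H)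
          (((fun k : Fin 4 => (X k.succ - C (b k) : A 4 K)) '' ((S' \ S : Finset (Fin 4)) : Set (Fin 4))) ∪
           ((fun i : Fin 4 => (X i.succ - C (b i) * X j.succ : A 4 K)) '' ((S' ∩ S : Finset (Fin 4)) : Set (Fin 4)))))))
    with hSt
  set 𝓔 := C₀.comap π with h𝓔
  haveI : IsProper π := hπ.isProper
  haveI : IsLocallyNoetherian W := LocallyOfFiniteType.isLocallyNoetherian π
  have hW : Scheme.IsRegular W := by
    haveI := AffineCoordBlowup.smooth_comp hπ
    exact Scheme.IsRegular.of_smooth (π ≫ AffinePointBlowup.f 4 K) (Scheme.isRegular_Spec (CommRingCat.of K))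
  have hP : Scheme.IsRegular (P 4 K) := by
    haveI := AffinePointBlowup.smooth_f 4 K
    exact Scheme.IsRegular.of_smooth (AffinePointBlowup.f 4 K) (Scheme.isRegular_Spec (CommRingCat.of K))
  have hT : Scheme.IsRegular St.subscheme := isRegular_subscheme_strictTransformIdeal_graph (S' := S') hj hjS' hπ hHS
  have hE : Scheme.IsRegular 𝓔.subscheme :=
    hπ.isRegular_subscheme_comap hP (Literature.AlgebraicGeometry.Hironaka2017.Lib.AffineCoordBlowupLSB.isRegular_CΛ 4 K _)
  have hTE : Scheme.IsRegular (St ⊔ 𝓔).subscheme :=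
    isRegular_subscheme_strictTransformIdeal_graph_sup (S' := S') hj hjS' hπ hHS
  refine hasSNCWith_of_isRsopPart_labels _ _ fun w => ?_
  haveI : IsRegularLocalRing (W.presheaf.stalk w) := hW w
  obtain ⟨e, he0, hEe⟩ := hπ.isEffectiveCartier.exists_stalkIdeal_eq_span w
  have hD : ∀ D : {D : W.IdealSheafData // D ∈ [𝓔] ∧ w ∈ D.support}, D.1 = 𝓔 := fun D =>
    List.mem_singleton.mp D.2.1
  have hinj : ∀ {m : ℕ} (i₀ : Fin m),
      Function.Injective (fun _ : {D : W.IdealSheafData // D ∈ [𝓔] ∧ w ∈ D.support} => i₀) :=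
    fun i₀ D₁ D₂ _ => Subtype.ext ((hD D₁).trans (hD D₂).symm)
  have hsat : ∀ a, e * a ∈ stalkIdeal St w → a ∈ stalkIdeal St w := by
    intro a ha
    rw [hSt, stalkIdeal_strictTransformIdeal, ← h𝓔, hEe] at ha ⊢
    exact mem_iSup_colon_span_pow_of_mul_mem_left _ e a ha
  by_cases hwZ : w ∈ (St ⊔ 𝓔).support
  · -- point of the centre `E₁ ∩ T″`
    have hw2 : w ∈ St.support ∧ w ∈ 𝓔.support := by
      rw [Scheme.IdealSheafData.support_sup] at hwZ; exact hwZ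
    have he : e ∈ maximalIdeal (W.presheaf.stalk w) := by
      have h1 := (mem_support_iff_stalkIdeal_le 𝓔 w).mp hw2.2
      rw [hEe] at h1
      exact h1 (Ideal.mem_span_singleton_self e)
    haveI := isRegularLocalRing_stalk_quotient_stalkIdeal hT hw2.1
    have hreg2 : IsRegularLocalRing (W.presheaf.stalk w ⧸ (stalkIdeal St w ⊔ Ideal.span {e})) := by
      rw [← hEe, ← stalkIdeal_sup]
      exact isRegularLocalRing_stalk_quotient_stalkIdeal hTE hwZ
    obtain ⟨m, z, i₀, Sset, hz, hzi, hzS⟩ := exists_isRsopPart_labels_of_saturated he hsat hreg2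
    refine ⟨m, z, hz, ⟨fun _ => i₀, hinj i₀, fun D => by rw [hD D, hEe, hzi]⟩, fun _ => ⟨insert i₀ Sset, ?_⟩⟩
    rw [stalkIdeal_sup, hEe, Set.image_insert_eq, Ideal.span_insert, hzi, hzS, sup_comm]
  · by_cases hwE : w ∈ 𝓔.support
    · have he : e ∈ maximalIdeal (W.presheaf.stalk w) := by
        have h1 := (mem_support_iff_stalkIdeal_le 𝓔 w).mp hwE
        rw [hEe] at h1
        exact h1 (Ideal.mem_span_singleton_self e)
      haveI : IsRegularLocalRing (W.presheaf.stalk w ⧸ (⊥ : Ideal (W.presheaf.stalk w))) :=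
        IsRegularLocalRing.of_ringEquiv (RingEquiv.quotientBot (W.presheaf.stalk w)).symm
      have hsat0 : ∀ a, e * a ∈ (⊥ : Ideal (W.presheaf.stalk w)) → a ∈ (⊥ : Ideal (W.presheaf.stalk w)) := by
        intro a ha
        rw [Ideal.mem_bot] at ha ⊢
        exact (mem_nonZeroDivisors_iff_right.mp he0) a (by rw [mul_comm]; exact ha)
      have hreg1 : IsRegularLocalRing (W.presheaf.stalk w ⧸ ((⊥ : Ideal (W.presheaf.stalk w)) ⊔ Ideal.span {e})) := by
        rw [bot_sup_eq, ← hEe]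
        exact isRegularLocalRing_stalk_quotient_stalkIdeal hE hwE
      obtain ⟨m, z, i₀, Sset, hz, hzi, -⟩ := exists_isRsopPart_labels_of_saturated he hsat0 hreg1
      exact ⟨m, z, hz, ⟨fun _ => i₀, hinj i₀, fun D => by rw [hD D, hEe, hzi]⟩, fun h => (hwZ h).elim⟩
    · have hnoD : ∀ D : {D : W.IdealSheafData // D ∈ [𝓔] ∧ w ∈ D.support}, False := fun D =>
        hwE ((hD D) ▸ D.2.2)
      exact ⟨0, Fin.elim0, isRsopPart_empty _, ⟨fun D => (hnoD D).elim, fun D => (hnoD D).elim,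
        fun D => (hnoD D).elim⟩, fun h => (hwZ h).elim⟩

/-! ## §3 The closure of the chart centre is a piece of `Z'` -/

/-- **The closure is an irreducible component of `V(Z')`** (`j ∈ S'`): `V(Z') ∩ (chart) = φ(V(z, x_{S'}))` is a non-empty
open irreducible part of the closed set `V(Z')`. -/
theorem closureImage_mem_boundaryPieces (hj : j ∈ S) (hjS' : j ∈ S') (hbj : b j = 0)
    (h0 : Θ (X 0) = X 0 + rename Fin.succ h) (hs : ∀ i : Fin 4, Θ (X i.succ) = X i.succ + C (b i))
    (hπ : IsBlowup π (AffineCoordBlowup.𝓘Λ 4 K (insert 0 (Fin.succ '' (S : Set (Fin 4))))))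
    {H : MvPolynomial (Fin 4) K} (hH : coordBlowupSubst K (S : Set (Fin 4)) j H =
      X j * aeval (fun k => if k ∈ S' then (0 : MvPolynomial (Fin 4) K) else X k - C (b k)) h)
    [NoetherianSpace W] :
    haveI : IsIso (CommRingCat.ofHom (Θ : A 4 K →+* A 4 K)) :=
      (inferInstance : IsIso Θ.toRingEquiv.toCommRingCatIso.hom)
    closureImage (Spec.map (CommRingCat.ofHom (Θ : A 4 K →+* A 4 K)) ≫ AffineCoordBlowup.chartImm hπ (succ_mem_centreVars hj))
        ((AffineCoordBlowup.𝓘Λ 4 K (insert 0 (Fin.succ '' (S' : Set (Fin 4))))).support : Set (P 4 K)) ∈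
      Kollar2007.boundaryPieces (strictTransformIdeal π (AffineCoordBlowup.𝓘Λ 4 K (insert 0 (Fin.succ '' (S : Set (Fin 4)))))
        (Hironaka2005.idealSheafOf (Ideal.span (insert (X 0 - rename Fin.succ H)
          (((fun k : Fin 4 => (X k.succ - C (b k) : A 4 K)) '' ((S'.erase j \ S : Finset (Fin 4)) : Set (Fin 4))) ∪
           ((fun i : Fin 4 => (X i.succ - C (b i) * X j.succ : A 4 K)) ''
             ((S'.erase j ∩ S : Finset (Fin 4)) : Set (Fin 4))))))) ⊔
        (AffineCoordBlowup.𝓘Λ 4 K (insert 0 (Fin.succ '' (S : Set (Fin 4))))).comap π) := by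
  haveI : IsIso (CommRingCat.ofHom (Θ : A 4 K →+* A 4 K)) :=
    (inferInstance : IsIso Θ.toRingEquiv.toCommRingCatIso.hom)
  set φ := Spec.map (CommRingCat.ofHom (Θ : A 4 K →+* A 4 K)) ≫ AffineCoordBlowup.chartImm hπ (succ_mem_centreVars hj)
    with hφ
  set Z' := strictTransformIdeal π (AffineCoordBlowup.𝓘Λ 4 K (insert 0 (Fin.succ '' (S : Set (Fin 4)))))
        (Hironaka2005.idealSheafOf (Ideal.span (insert (X 0 - rename Fin.succ H)
          (((fun k : Fin 4 => (X k.succ - C (b k) : A 4 K)) '' ((S'.erase j \ S : Finset (Fin 4)) : Set (Fin 4))) ∪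
           ((fun i : Fin 4 => (X i.succ - C (b i) * X j.succ : A 4 K)) ''
             ((S'.erase j ∩ S : Finset (Fin 4)) : Set (Fin 4))))))) ⊔
        (AffineCoordBlowup.𝓘Λ 4 K (insert 0 (Fin.succ '' (S : Set (Fin 4))))).comap π with hZ'
  have hcomap : Z'.comap φ = AffineCoordBlowup.𝓘Λ 4 K (insert 0 (Fin.succ '' (S' : Set (Fin 4)))) :=
    comap_chart_strictTransformIdeal_graph_erase_sup hj hjS' hbj h0 hs hπ hH
  rw [Kollar2007.mem_boundaryPieces_iff, coe_closureImage, AffineCoordBlowup.support_𝓘Λ]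
  refine closure_mem_componentsIn_of_inter_range (U := Set.range φ) (Z'.support).isClosed
    φ.isOpenEmbedding.isOpen_range ?_ ?_
  · ext w
    constructor
    · rintro ⟨hw, y, rfl⟩
      refine ⟨y, ?_, rfl⟩
      have h2 : y ∈ (Z'.comap φ).support := by rw [Scheme.IdealSheafData.support_comap]; exact hw
      rw [hcomap, AffineCoordBlowup.support_𝓘Λ] at h2
      exact h2
    · rintro ⟨y, hy, rfl⟩
      refine ⟨?_, y, rfl⟩
      have h2 : y ∈ (Z'.comap φ).support := by rw [hcomap, AffineCoordBlowup.support_𝓘Λ]; exact hy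
      rw [Scheme.IdealSheafData.support_comap] at h2
      exact h2
  · exact (AffineCoordBlowup.isIrreducible_CΛ 4 K _).image φ φ.continuous.continuousOn

/-! ## §4 Q1 and Q3 for `j ∈ S'`, then for every `S'`, and the package -/

/-- **Q1 (`j ∈ S'`)**: the global centre of a next coordinate centre INSIDE the new exceptional divisor is a regular
scheme — a piece of the regular centre `E₁ ∩ T″`. -/
theorem isRegular_globalCentre_of_reading_of_mem [Fact p.Prime] [CharP K p] (hj : j ∈ S) (hjS' : j ∈ S')
    (hbj : b j = 0) (h0 : Θ (X 0) = X 0 + rename Fin.succ h) (hs : ∀ i : Fin 4, Θ (X i.succ) = X i.succ + C (b i))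
    (hπ : IsBlowup π (AffineCoordBlowup.𝓘Λ 4 K (insert 0 (Fin.succ '' (S : Set (Fin 4))))))
    (hperm : (p : ℕ∞) ≤ CentreBlowup.ordAlong S F)
    (hread : Θ (coordBlowupSubst K (insert 0 (Fin.succ '' (S : Set (Fin 4)))) j.succ (hyp p F)) =
      X j.succ ^ p * hyp p F₁)
    (hperm' : (p : ℕ∞) ≤ CentreBlowup.ordAlong S' F₁) :
    haveI : IsIso (CommRingCat.ofHom (Θ : A 4 K →+* A 4 K)) :=
      (inferInstance : IsIso Θ.toRingEquiv.toCommRingCatIso.hom)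
    Scheme.IsRegular (vanishingIdeal (closureImage
      (Spec.map (CommRingCat.ofHom (Θ : A 4 K →+* A 4 K)) ≫ AffineCoordBlowup.chartImm hπ (succ_mem_centreVars hj))
      ((AffineCoordBlowup.𝓘Λ 4 K (insert 0 (Fin.succ '' (S' : Set (Fin 4))))).support : Set (P 4 K)))).subscheme := by
  haveI : IsProper π := hπ.isProper
  haveI : IsLocallyNoetherian W := LocallyOfFiniteType.isLocallyNoetherian π
  haveI : CompactSpace W := QuasiCompact.compactSpace_of_compactSpace π
  haveI : IsNoetherian W := ⟨⟩
  obtain ⟨H, hH⟩ := exists_lift_twist hj hbj h0 hs hperm hread hperm'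
  have hHS := mem_span_X_of_lift hj hH
  have hjS'' : j ∉ S'.erase j := Finset.notMem_erase j S'
  have hZreg := isRegular_subscheme_strictTransformIdeal_graph_sup (S' := S'.erase j) (b := b) hj hjS'' hπ hHS
  exact isRegular_subscheme_vanishingIdeal_piece hZreg (isPiecePartition_boundaryPieces_of_isRegular hZreg)
    (closureImage_mem_boundaryPieces hj hjS' hbj h0 hs hπ hH)

/-- **Q3 (`j ∈ S'`)**: the global centre of a next centre inside `E₁` has simple normal crossings with `[E₁]` (the
boundary of the transformed root marked ideal). -/
theorem hasSNCWith_transform_boundary_globalCentre_of_mem [Fact p.Prime] [CharP K p] (hj : j ∈ S) (hjS' : j ∈ S')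
    (hbj : b j = 0) (h0 : Θ (X 0) = X 0 + rename Fin.succ h) (hs : ∀ i : Fin 4, Θ (X i.succ) = X i.succ + C (b i))
    (hπ : IsBlowup π (AffineCoordBlowup.𝓘Λ 4 K (insert 0 (Fin.succ '' (S : Set (Fin 4))))))
    (hperm : (p : ℕ∞) ≤ CentreBlowup.ordAlong S F)
    (hread : Θ (coordBlowupSubst K (insert 0 (Fin.succ '' (S : Set (Fin 4)))) j.succ (hyp p F)) =
      X j.succ ^ p * hyp p F₁)
    (hperm' : (p : ℕ∞) ≤ CentreBlowup.ordAlong S' F₁) :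
    haveI : IsIso (CommRingCat.ofHom (Θ : A 4 K →+* A 4 K)) :=
      (inferInstance : IsIso Θ.toRingEquiv.toCommRingCatIso.hom)
    HasSNCWith
      ((⟨hypSheaf p F, [], p⟩ : MarkedIdeal (P 4 K)).transform π
        (AffineCoordBlowup.𝓘Λ 4 K (insert 0 (Fin.succ '' (S : Set (Fin 4)))))).boundary
      (vanishingIdeal (closureImage
        (Spec.map (CommRingCat.ofHom (Θ : A 4 K →+* A 4 K)) ≫ AffineCoordBlowup.chartImm hπ (succ_mem_centreVars hj))
        ((AffineCoordBlowup.𝓘Λ 4 K (insert 0 (Fin.succ '' (S' : Set (Fin 4))))).support : Set (P 4 K)))) := by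
  haveI : IsProper π := hπ.isProper
  haveI : IsLocallyNoetherian W := LocallyOfFiniteType.isLocallyNoetherian π
  haveI : CompactSpace W := QuasiCompact.compactSpace_of_compactSpace π
  haveI : IsNoetherian W := ⟨⟩
  obtain ⟨H, hH⟩ := exists_lift_twist hj hbj h0 hs hperm hread hperm'
  have hHS := mem_span_X_of_lift hj hH
  have hjS'' : j ∉ S'.erase j := Finset.notMem_erase j S'
  have hZreg := isRegular_subscheme_strictTransformIdeal_graph_sup (S' := S'.erase j) (b := b) hj hjS'' hπ hHS
  rw [MarkedIdeal.transform_boundary, List.map_nil, List.nil_append]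
  exact (hasSNCWith_exceptional_strictTransformIdeal_graph_sup (S' := S'.erase j) (b := b) hj hjS'' hπ hHS).centrePiece
    (isPiecePartition_boundaryPieces_of_isRegular hZreg) (closureImage_mem_boundaryPieces hj hjS' hbj h0 hs hπ hH)

/-- **Q1 OF THE S3-GLOB QUESTION — EVERY `S'`** (signature of record; `[IsAlgClosed K]` weakened to any field of
characteristic `p`). -/
theorem isRegular_globalCentre_of_reading [Fact p.Prime] [CharP K p] (hj : j ∈ S) (hbj : b j = 0)
    (h0 : Θ (X 0) = X 0 + rename Fin.succ h) (hs : ∀ i : Fin 4, Θ (X i.succ) = X i.succ + C (b i))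
    (hπ : IsBlowup π (AffineCoordBlowup.𝓘Λ 4 K (insert 0 (Fin.succ '' (S : Set (Fin 4))))))
    (hperm : (p : ℕ∞) ≤ CentreBlowup.ordAlong S F)
    (hread : Θ (coordBlowupSubst K (insert 0 (Fin.succ '' (S : Set (Fin 4)))) j.succ (hyp p F)) =
      X j.succ ^ p * hyp p F₁)
    (hperm' : (p : ℕ∞) ≤ CentreBlowup.ordAlong S' F₁) :
    haveI : IsIso (CommRingCat.ofHom (Θ : A 4 K →+* A 4 K)) :=
      (inferInstance : IsIso Θ.toRingEquiv.toCommRingCatIso.hom)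
    Scheme.IsRegular (vanishingIdeal (closureImage
      (Spec.map (CommRingCat.ofHom (Θ : A 4 K →+* A 4 K)) ≫ AffineCoordBlowup.chartImm hπ (succ_mem_centreVars hj))
      ((AffineCoordBlowup.𝓘Λ 4 K (insert 0 (Fin.succ '' (S' : Set (Fin 4))))).support : Set (P 4 K)))).subscheme := by
  by_cases hjS' : j ∈ S'
  · exact isRegular_globalCentre_of_reading_of_mem hj hjS' hbj h0 hs hπ hperm hread hperm'
  · exact isRegular_globalCentre_of_reading_of_not_mem hj hjS' hbj h0 hs hπ hperm hread hperm'

/-- **Q3 OF THE S3-GLOB QUESTION — EVERY `S'`** (signature of record). -/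
theorem hasSNCWith_transform_boundary_globalCentre [Fact p.Prime] [CharP K p] (hj : j ∈ S) (hbj : b j = 0)
    (h0 : Θ (X 0) = X 0 + rename Fin.succ h) (hs : ∀ i : Fin 4, Θ (X i.succ) = X i.succ + C (b i))
    (hπ : IsBlowup π (AffineCoordBlowup.𝓘Λ 4 K (insert 0 (Fin.succ '' (S : Set (Fin 4))))))
    (hperm : (p : ℕ∞) ≤ CentreBlowup.ordAlong S F)
    (hread : Θ (coordBlowupSubst K (insert 0 (Fin.succ '' (S : Set (Fin 4)))) j.succ (hyp p F)) =
      X j.succ ^ p * hyp p F₁)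
    (hperm' : (p : ℕ∞) ≤ CentreBlowup.ordAlong S' F₁) :
    haveI : IsIso (CommRingCat.ofHom (Θ : A 4 K →+* A 4 K)) :=
      (inferInstance : IsIso Θ.toRingEquiv.toCommRingCatIso.hom)
    HasSNCWith
      ((⟨hypSheaf p F, [], p⟩ : MarkedIdeal (P 4 K)).transform π
        (AffineCoordBlowup.𝓘Λ 4 K (insert 0 (Fin.succ '' (S : Set (Fin 4)))))).boundary
      (vanishingIdeal (closureImage
        (Spec.map (CommRingCat.ofHom (Θ : A 4 K →+* A 4 K)) ≫ AffineCoordBlowup.chartImm hπ (succ_mem_centreVars hj))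
        ((AffineCoordBlowup.𝓘Λ 4 K (insert 0 (Fin.succ '' (S' : Set (Fin 4))))).support : Set (P 4 K)))) := by
  by_cases hjS' : j ∈ S'
  · exact hasSNCWith_transform_boundary_globalCentre_of_mem hj hjS' hbj h0 hs hπ hperm hread hperm'
  · exact hasSNCWith_transform_boundary_globalCentre_of_not_mem hj hjS' hbj h0 hs hπ hperm hread hperm'

/-- **THE S3-GLOB PACKAGE AT DEPTH 2 — EVERY `S'`** (the signature of record `globalCentre_admissible_package`, HOME
`lean-g4/ChartClosureSignature.lean`, desk WORD #97 (c)): see the module docstring. -/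
theorem globalCentre_admissible_package [hp : Fact p.Prime] [CharP K p] [IsAlgClosed K] [DecidableEq K] (hj : j ∈ S)
    (hbj : b j = 0) (s : State K) (hperm : (p : ℕ∞) ≤ CentreBlowup.ordAlong S s.F)
    (hπ : IsBlowup π (AffineCoordBlowup.𝓘Λ 4 K (insert 0 (Fin.succ '' (S : Set (Fin 4))))))
    (hperm' : (p : ℕ∞) ≤ CentreBlowup.ordAlong S' (CentreBlowup.step p S j b s).F) :
    ∃ (Θ : A 4 K ≃ₐ[K] A 4 K) (h : MvPolynomial (Fin 4) K) (_ : IsIso (CommRingCat.ofHom (Θ : A 4 K →+* A 4 K))),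
      Θ (X 0) = X 0 + rename Fin.succ h ∧ (∀ i : Fin 4, Θ (X i.succ) = X i.succ + C (b i)) ∧
      let φ := Spec.map (CommRingCat.ofHom (Θ : A 4 K →+* A 4 K)) ≫ AffineCoordBlowup.chartImm hπ (succ_mem_centreVars hj)
      let Zc := vanishingIdeal (closureImage φ ((AffineCoordBlowup.𝓘Λ 4 K
        (insert 0 (Fin.succ '' (S' : Set (Fin 4))))).support : Set (P 4 K)))
      let M' := ((⟨hypSheaf p s.F, [], p⟩ : MarkedIdeal (P 4 K)).transform π
        (AffineCoordBlowup.𝓘Λ 4 K (insert 0 (Fin.succ '' (S : Set (Fin 4))))))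
      M'.ideal.comap φ = hypSheaf p (CentreBlowup.step p S j b s).F ∧
      Zc.comap φ = AffineCoordBlowup.𝓘Λ 4 K (insert 0 (Fin.succ '' (S' : Set (Fin 4)))) ∧
      Scheme.IsRegular Zc.subscheme ∧ (Zc.support : Set W) ⊆ M'.support ∧ HasSNCWith M'.boundary Zc := by
  haveI : PerfectRing K p := PerfectRing.ofSurjective K p fun x => IsAlgClosed.exists_pow_nat_eq x hp.out.pos
  obtain ⟨θ, h, h0, hs, h1, -⟩ := exists_clean_translate_hyp_eq_step p hj hbj s hperm
  let Θ : A 4 K ≃ₐ[K] A 4 K := (AffinePointBlowup.translateEquiv (Fin.cases 0 b)).trans θ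
  have hΘ0 : Θ (X 0) = X 0 + rename Fin.succ h := by
    change θ (AffinePointBlowup.translateEquiv (Fin.cases 0 b) (X 0)) = _
    rw [AffinePointBlowup.translateEquiv_X, Fin.cases_zero, C_0, add_zero, h0]
  have hΘs : ∀ i : Fin 4, Θ (X i.succ) = X i.succ + C (b i) := fun i => by
    change θ (AffinePointBlowup.translateEquiv (Fin.cases 0 b) (X i.succ)) = _
    rw [AffinePointBlowup.translateEquiv_X, Fin.cases_succ, map_add, hs]
    exact congrArg _ (θ.commutes (b i))
  have hread : Θ (coordBlowupSubst K (insert 0 (Fin.succ '' (S : Set (Fin 4)))) j.succ (hyp p s.F)) =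
      X j.succ ^ p * hyp p (CentreBlowup.step p S j b s).F := by
    change θ (AffinePointBlowup.translateEquiv (Fin.cases 0 b) _) = _
    rw [← h1]
    rfl
  haveI hiso : IsIso (CommRingCat.ofHom (Θ : A 4 K →+* A 4 K)) :=
    (inferInstance : IsIso Θ.toRingEquiv.toCommRingCatIso.hom)
  refine ⟨Θ, h, hiso, hΘ0, hΘs, ?_, ?_, ?_, ?_, ?_⟩
  · exact comap_chart_transform_ideal_of_reading hj hbj hΘ0 hΘs hπ hperm hread _ rfl rfl
  · exact comap_globalCentre _ _
  · exact isRegular_globalCentre_of_reading hj hbj hΘ0 hΘs hπ hperm hread hperm'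
  · exact support_globalCentre_subset_support_transform hj hbj hΘ0 hΘs hπ hperm hread hperm'
  · exact hasSNCWith_transform_boundary_globalCentre hj hbj hΘ0 hΘs hπ hperm hread hperm'

end Scheme

end ChartDictionary

end Summit.ResolutionOfSingularities.ResolutionOfSingularities.Theorems.PIDim4

end
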